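import Summits.AtomisticToContinuum.Crystallization.Theorems.FrustratedLawDichotomyStrainedPatchHomEntrySearch

/-!
# SYMMETRY REDUCTION of the fcc half of `(H)`: it suffices to certify deformations with SORTED diagonal `u₀₀ ≥ u₁₁ ≥ u₂₂`
# (coordinate permutations, ×6), the vacuous-leaf verdict `domOut`, and the tree / search theorems over the sorted domain

decomp-a2c hand-1 g21 (crux `AperiodicFrustratedLawGap`, stmt-AtomisticToContinuum-27623; CERT-DESIGN-g44 §0 «lattice symmetry: certify a closed
fundamental domain and cover the rest by symmetry, expected saving ×24–48 (fcc)»).  This module does the COORDINATE-PERMUTATION part (the subgroup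
`S₃` of the point group `O_h`; saving ×6), which needs no tail argument: a coordinate permutation `P_σ` maps the fcc frame to itself
(`P_σ fᵢ = f_{σ i}`), so the label box `[−7,7]³ ∖ 0` is invariant and the box sum is reindexed exactly.

* §1 `permIso σ : E3 ≃ₗᵢ[ℝ] E3` (Mathlib's `LinearIsometryEquiv.piLpCongrLeft`), its action on coordinates, basis vectors and the fcc frame;
* §2 conjugation `V = P_σ ∘ U ∘ P_σ⁻¹`: entries `V_ab = U_{σ⁻¹a, σ⁻¹b}`, self-adjointness / positivity / `‖V − 1‖ ≤ 1/4` transfer, and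
  `latPt U f b = P_σ⁻¹ (latPt V f (b ∘ σ⁻¹))`;
* §3 transfer of the two disjuncts from `V` back to `U`: the box sum is EQUAL (`boxSum_conj`), the prune disjunct transports by hand-1 g19's
  `…HomIsometry.pruneFcc_comp` plus relabelling of the realisation set;
* §4 ★★ `fccHalf_of_sorted`: the fcc dichotomy (prune ∨ `m`-floor) for all self-adjoint positive `U` with `‖U − 1‖ ≤ 1/4` follows from the same
  dichotomy for those with `u₁₁ ≤ u₀₀` and `u₂₂ ≤ u₁₁` (six cases, one permutation each);
* §5 the certificate side: `domOut c w` (the entry box lies entirely outside the sorted domain — a vacuous leaf), the verdict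
  `entryLeafOKS μ := domOut ∨ entryLeafOKT μ`, ★★ `fccHalf_of_entryTreeSorted` (tree driver with the hver RELATIVISED to the sorted domain ⟹ `hfcc`
  verbatim), ★★ `fccHalf_of_entrySearchSorted`, and ★★★ `homFloor_of_entrySearchesSorted` (`(H) HomFloor m` from two search Booleans, the fcc search
  now only over sorted boxes).

0 sorry; standard axioms; no instances / notation / `#eval`; the only new `def`s are `permIso` (an abbreviation of a Mathlib isometry), `domOut`,
`entryLeafOKS`.  `--supports stmt-AtomisticToContinuum-27623`.
-/

namespace Summit.AtomisticToContinuum.Crystallization.Theorems.FrustratedLawDichotomyStrainedPatchHomEntrySym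

open scoped BigOperators RealInnerProductSpace
open Literature.Analysis.ValidatedNumerics.Numerics
open Summit.AtomisticToContinuum.Crystallization.Theorems.ChargedEnergyGapNegative (E3)
open Summit.AtomisticToContinuum.Crystallization.Theorems.FrustratedLawDichotomySchurCut (effPot w₄₅ ω₄)
open Summit.AtomisticToContinuum.Crystallization.Theorems.FrustratedLawDichotomyAveragingRuleTightFree (TightNearCap BadNearCap)
open Summit.AtomisticToContinuum.Crystallization.Theorems.FrustratedLawDichotomyExemptAbsorption (ExemptNear)
open Summit.AtomisticToContinuum.Crystallization.Theorems.FrustratedLawDichotomyStrainedPatchHomSplit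
open Summit.AtomisticToContinuum.Crystallization.Theorems.FrustratedLawDichotomyStrainedPatchHomPolar (latPt_comp)
open Summit.AtomisticToContinuum.Crystallization.Theorems.FrustratedLawDichotomyStrainedPatchHomIsometry (pruneFcc_comp)
open Summit.AtomisticToContinuum.Crystallization.Theorems.FrustratedLawDichotomyStrainedPatchHomPrunedPolar (homFloor_of_prunedBoxSums_selfAdjoint)
open Summit.AtomisticToContinuum.Crystallization.Theorems.FrustratedLawDichotomyStrainedPatchHomCertTree (CertTree treeOK treeOK_sound)
open Summit.AtomisticToContinuum.Crystallization.Theorems.FrustratedLawDichotomyStrainedPatchHomEntryGram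
open Summit.AtomisticToContinuum.Crystallization.Theorems.FrustratedLawDichotomyStrainedPatchHomEntryGramHcp (rootCH rootWH)
open Summit.AtomisticToContinuum.Crystallization.Theorems.FrustratedLawDichotomyStrainedPatchHomEntryFitHcp (entryLeafOKH2 entryLeafOKH2_sound)
open Summit.AtomisticToContinuum.Crystallization.Theorems.FrustratedLawDichotomyStrainedPatchHomEntryTable (entryLeafOKT entryLeafOKT_sound muRec)
open Summit.AtomisticToContinuum.Crystallization.Theorems.FrustratedLawDichotomyStrainedPatchHomEntrySearch
open Literature.Barriers.AtomisticToContinuum.FlatleyTheil2015 (fccVec)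

/-! ## §1. Coordinate permutations of `E3` -/

/-- The coordinate permutation `(P_σ w) a = w (σ⁻¹ a)` as a linear isometry of `E3` (Mathlib's `piLpCongrLeft`). -/
noncomputable def permIso (σ : Equiv.Perm (Fin 3)) : E3 ≃ₗᵢ[ℝ] E3 := LinearIsometryEquiv.piLpCongrLeft 2 ℝ ℝ σ

/-- Coordinates of `P_σ w`. [formal bookkeeping] -/
theorem permIso_apply (σ : Equiv.Perm (Fin 3)) (w : E3) (a : Fin 3) : permIso σ w a = w (σ.symm a) := rfl

/-- `P_σ⁻¹ = P_{σ⁻¹}`. [formal bookkeeping] -/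
theorem permIso_symm (σ : Equiv.Perm (Fin 3)) : (permIso σ).symm = permIso σ.symm :=
  LinearIsometryEquiv.piLpCongrLeft_symm σ

/-- Coordinates of `P_σ⁻¹ w`. [formal bookkeeping] -/
theorem permIso_symm_apply (σ : Equiv.Perm (Fin 3)) (w : E3) (a : Fin 3) : (permIso σ).symm w a = w (σ a) := by
  rw [permIso_symm, permIso_apply, Equiv.symm_symm]

/-- `P_σ⁻¹ e_b = e_{σ⁻¹ b}`. [formal bookkeeping] -/
theorem permIso_symm_single (σ : Equiv.Perm (Fin 3)) (b : Fin 3) :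
    (permIso σ).symm (EuclideanSpace.single b (1 : ℝ)) = EuclideanSpace.single (σ.symm b) (1 : ℝ) := by
  ext x
  rw [permIso_symm_apply]
  simp [PiLp.single_apply, Equiv.eq_symm_apply]

/-- `P_σ fᵢ = f_{σ i}` — a coordinate permutation maps the fcc frame to itself. [folklore] -/
theorem permIso_fccVec (σ : Equiv.Perm (Fin 3)) (i : Fin 3) : permIso σ (fccVec i) = fccVec (σ i) := by
  ext x
  rw [permIso_apply, fccVec_apply, fccVec_apply]
  simp only [Equiv.symm_apply_eq]

/-- `P_σ (Σ bᵢ fᵢ) = Σ_j b_{σ⁻¹ j} f_j`. [formal bookkeeping] -/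
theorem permIso_sum_smul_fccVec (σ : Equiv.Perm (Fin 3)) (b : Fin 3 → ℤ) :
    permIso σ (∑ i : Fin 3, ((b i : ℤ) : ℝ) • fccVec i) = ∑ j : Fin 3, ((b (σ.symm j) : ℤ) : ℝ) • fccVec j := by
  rw [map_sum]
  simp_rw [map_smul, permIso_fccVec]
  exact (Equiv.sum_comp σ (fun j => ((b (σ.symm j) : ℤ) : ℝ) • fccVec j)).symm.trans (by simp) |>.symm

/-! ## §2. Conjugation `V = P_σ ∘ U ∘ P_σ⁻¹` -/

/-- Pointwise form of the conjugate. [formal bookkeeping] -/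
theorem conj_apply (σ : Equiv.Perm (Fin 3)) (U : E3 →L[ℝ] E3) (w : E3) :
    ((permIso σ : E3 →L[ℝ] E3).comp (U.comp ((permIso σ).symm : E3 →L[ℝ] E3))) w = permIso σ (U ((permIso σ).symm w)) := rfl

/-- `U` from its conjugate: `U w = P_σ⁻¹ (V (P_σ w))`. [formal bookkeeping] -/
theorem apply_eq_symm_conj (σ : Equiv.Perm (Fin 3)) (U : E3 →L[ℝ] E3) (w : E3) :
    U w = (permIso σ).symm (((permIso σ : E3 →L[ℝ] E3).comp (U.comp ((permIso σ).symm : E3 →L[ℝ] E3))) (permIso σ w)) := by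
  rw [conj_apply, LinearIsometryEquiv.symm_apply_apply, LinearIsometryEquiv.symm_apply_apply]

/-- ★ Entries of the conjugate: `V_ab = U_{σ⁻¹ a, σ⁻¹ b}`. [folklore] -/
theorem conj_entry (σ : Equiv.Perm (Fin 3)) (U : E3 →L[ℝ] E3) (a b : Fin 3) :
    (((permIso σ : E3 →L[ℝ] E3).comp (U.comp ((permIso σ).symm : E3 →L[ℝ] E3))) (EuclideanSpace.single b (1 : ℝ))) a =
      (U (EuclideanSpace.single (σ.symm b) (1 : ℝ))) (σ.symm a) := by
  rw [conj_apply, permIso_apply, permIso_symm_single]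

/-- Self-adjointness transfers to the conjugate. [folklore] -/
theorem conj_selfAdjoint (σ : Equiv.Perm (Fin 3)) {U : E3 →L[ℝ] E3} (hsa : ∀ v w : E3, ⟪U v, w⟫ = ⟪v, U w⟫) (v w : E3) :
    ⟪((permIso σ : E3 →L[ℝ] E3).comp (U.comp ((permIso σ).symm : E3 →L[ℝ] E3))) v, w⟫ =
      ⟪v, ((permIso σ : E3 →L[ℝ] E3).comp (U.comp ((permIso σ).symm : E3 →L[ℝ] E3))) w⟫ := by
  rw [conj_apply, conj_apply]
  have h1 : ⟪permIso σ (U ((permIso σ).symm v)), w⟫ = ⟪U ((permIso σ).symm v), (permIso σ).symm w⟫ := by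
    rw [← LinearIsometryEquiv.inner_map_map (permIso σ) (U ((permIso σ).symm v)) ((permIso σ).symm w),
      LinearIsometryEquiv.apply_symm_apply]
  have h2 : ⟪v, permIso σ (U ((permIso σ).symm w))⟫ = ⟪(permIso σ).symm v, U ((permIso σ).symm w)⟫ := by
    rw [← LinearIsometryEquiv.inner_map_map (permIso σ) ((permIso σ).symm v) (U ((permIso σ).symm w)),
      LinearIsometryEquiv.apply_symm_apply]
  rw [h1, h2, hsa]

/-- Positivity transfers to the conjugate. [folklore] -/
theorem conj_pos (σ : Equiv.Perm (Fin 3)) {U : E3 →L[ℝ] E3} (hpos : ∀ w : E3, 0 ≤ ⟪w, U w⟫) (w : E3) :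
    0 ≤ ⟪w, ((permIso σ : E3 →L[ℝ] E3).comp (U.comp ((permIso σ).symm : E3 →L[ℝ] E3))) w⟫ := by
  rw [conj_apply]
  have e : ⟪w, permIso σ (U ((permIso σ).symm w))⟫ = ⟪(permIso σ).symm w, U ((permIso σ).symm w)⟫ := by
    rw [← LinearIsometryEquiv.inner_map_map (permIso σ) ((permIso σ).symm w) (U ((permIso σ).symm w)),
      LinearIsometryEquiv.apply_symm_apply]
  rw [e]
  exact hpos _

/-- `‖V − 1‖ ≤ ‖U − 1‖` for the conjugate (in fact equality). [folklore] -/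
theorem conj_norm_sub_one_le (σ : Equiv.Perm (Fin 3)) (U : E3 →L[ℝ] E3) :
    ‖(permIso σ : E3 →L[ℝ] E3).comp (U.comp ((permIso σ).symm : E3 →L[ℝ] E3)) - 1‖ ≤ ‖U - 1‖ := by
  refine ContinuousLinearMap.opNorm_le_bound _ (norm_nonneg _) fun w => ?_
  have e : ((permIso σ : E3 →L[ℝ] E3).comp (U.comp ((permIso σ).symm : E3 →L[ℝ] E3)) - 1) w =
      permIso σ ((U - 1) ((permIso σ).symm w)) := by
    simp [map_sub]
  rw [e, LinearIsometryEquiv.norm_map]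
  calc ‖(U - 1) ((permIso σ).symm w)‖ ≤ ‖U - 1‖ * ‖(permIso σ).symm w‖ := (U - 1).le_opNorm _
    _ = ‖U - 1‖ * ‖w‖ := by rw [LinearIsometryEquiv.norm_map]

/-- ★ Lattice points: `latPt U f b = P_σ⁻¹ (latPt V f (b ∘ σ⁻¹))`. [folklore] -/
theorem latPt_eq_symm_conj (σ : Equiv.Perm (Fin 3)) (U : E3 →L[ℝ] E3) (b : Fin 3 → ℤ) :
    latPt U fccVec b = (permIso σ).symm
      (latPt ((permIso σ : E3 →L[ℝ] E3).comp (U.comp ((permIso σ).symm : E3 →L[ℝ] E3))) fccVec (b ∘ σ.symm)) := by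
  unfold latPt
  rw [apply_eq_symm_conj σ U, permIso_sum_smul_fccVec]
  rfl

/-- Lengths of lattice points agree: `‖latPt U f b‖ = ‖latPt V f (b ∘ σ⁻¹)‖`. [folklore] -/
theorem norm_latPt_eq_conj (σ : Equiv.Perm (Fin 3)) (U : E3 →L[ℝ] E3) (b : Fin 3 → ℤ) :
    ‖latPt U fccVec b‖ = ‖latPt ((permIso σ : E3 →L[ℝ] E3).comp (U.comp ((permIso σ).symm : E3 →L[ℝ] E3))) fccVec (b ∘ σ.symm)‖ := by
  rw [latPt_eq_symm_conj σ U b, LinearIsometryEquiv.norm_map]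

/-! ## §3. Transfer of the two disjuncts from the conjugate back to `U` -/

/-- The label box `[−7,7]³ ∖ 0` is invariant under relabelling by a coordinate permutation. [formal bookkeeping] -/
theorem mem_box_comp_iff (σ : Equiv.Perm (Fin 3)) (b : Fin 3 → ℤ) :
    b ∈ (Fintype.piFinset fun _ : Fin 3 => Finset.Icc (-7 : ℤ) 7).filter (fun b => b ≠ 0) ↔
      b ∘ σ.symm ∈ (Fintype.piFinset fun _ : Fin 3 => Finset.Icc (-7 : ℤ) 7).filter (fun b => b ≠ 0) := by
  simp only [Finset.mem_filter, Fintype.mem_piFinset, Function.comp_apply, ne_eq]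
  constructor
  · rintro ⟨h1, h2⟩
    refine ⟨fun a => h1 _, fun h => h2 ?_⟩
    funext i
    have := congrFun h (σ i)
    simpa using this
  · rintro ⟨h1, h2⟩
    refine ⟨fun a => by simpa using h1 (σ a), fun h => h2 ?_⟩
    funext i
    simp [h]

/-- ★ **BOX SUM IS INVARIANT**: `Σ_{b ∈ box} W ‖latPt U f b‖ = Σ_{b ∈ box} W ‖latPt V f b‖`. [folklore] -/
theorem boxSum_conj (σ : Equiv.Perm (Fin 3)) (U : E3 →L[ℝ] E3) (W : ℝ → ℝ) :
    ∑ b ∈ (Fintype.piFinset fun _ : Fin 3 => Finset.Icc (-7 : ℤ) 7).filter (fun b => b ≠ 0), W ‖latPt U fccVec b‖ =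
      ∑ b ∈ (Fintype.piFinset fun _ : Fin 3 => Finset.Icc (-7 : ℤ) 7).filter (fun b => b ≠ 0),
        W ‖latPt ((permIso σ : E3 →L[ℝ] E3).comp (U.comp ((permIso σ).symm : E3 →L[ℝ] E3))) fccVec b‖ := by
  have happ : ∀ b : Fin 3 → ℤ, (Equiv.arrowCongr σ (Equiv.refl ℤ)) b = b ∘ σ.symm := fun b => rfl
  refine Finset.sum_equiv (Equiv.arrowCongr σ (Equiv.refl ℤ)) (fun b => ?_) (fun b _ => ?_)
  · rw [happ]
    exact mem_box_comp_iff σ b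
  · rw [happ, norm_latPt_eq_conj σ U b]

/-- `latPt U f b = latPt (P_σ⁻¹ ∘ V) f (b ∘ σ⁻¹)` (composed form). [formal bookkeeping] -/
theorem latPt_eq_conj_comp (σ : Equiv.Perm (Fin 3)) (U : E3 →L[ℝ] E3) (b : Fin 3 → ℤ) :
    latPt U fccVec b = latPt ((((permIso σ).symm : E3 ≃ₗᵢ[ℝ] E3) : E3 →L[ℝ] E3).comp
      ((permIso σ : E3 →L[ℝ] E3).comp (U.comp ((permIso σ).symm : E3 →L[ℝ] E3)))) fccVec (b ∘ σ.symm) := by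
  rw [latPt_comp]
  exact latPt_eq_symm_conj σ U b

/-- The realisation set of the `U`-fcc ball is the realisation set of the `(P_σ⁻¹ ∘ V)`-fcc ball (relabel `a ↦ a ∘ σ⁻¹`). [folklore] -/
theorem range_set_eq_conj (σ : Equiv.Perm (Fin 3)) (U : E3 →L[ℝ] E3) (ϱ : ℝ) (x0 : E3) :
    {x : E3 | dist x x0 ≤ ϱ ∧ ∃ a : Fin 3 → ℤ, x = x0 + latPt U fccVec a} =
      {x : E3 | dist x x0 ≤ ϱ ∧ ∃ a : Fin 3 → ℤ, x = x0 +
        latPt ((((permIso σ).symm : E3 ≃ₗᵢ[ℝ] E3) : E3 →L[ℝ] E3).comp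
          ((permIso σ : E3 →L[ℝ] E3).comp (U.comp ((permIso σ).symm : E3 →L[ℝ] E3)))) fccVec a} := by
  ext x
  simp only [Set.mem_setOf_eq]
  refine and_congr_right fun _ => ⟨?_, ?_⟩
  · rintro ⟨a, ha⟩
    exact ⟨a ∘ σ.symm, by rw [ha, latPt_eq_conj_comp σ U a]⟩
  · rintro ⟨a, ha⟩
    have e : (a ∘ σ) ∘ σ.symm = a := by funext j; simp
    refine ⟨a ∘ σ, ?_⟩
    rw [latPt_eq_conj_comp σ U (a ∘ σ), e]
    exact ha

/-- ★ **PRUNE DISJUNCT TRANSFERS** from the conjugate `V` to `U` (via `…HomIsometry.pruneFcc_comp` with `R = P_σ⁻¹` and relabelling). [folklore] -/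
theorem prune_of_conj (σ : Equiv.Perm (Fin 3)) (U : E3 →L[ℝ] E3)
    (h : ∀ (M : ℕ) (z : Fin M → E3) (c : Fin M), Function.Injective z →
      Set.range z = {x : E3 | dist x (z c) ≤ 133 / 10 ∧ ∃ a : Fin 3 → ℤ,
        x = z c + latPt ((permIso σ : E3 →L[ℝ] E3).comp (U.comp ((permIso σ).symm : E3 →L[ℝ] E3))) fccVec a} →
      TightNearCap (9 / 5) (3 / 2) z c ∨ ExemptNear (9 / 5) ExRec z c ∨ BadNearCap (9 / 5) (3 / 2) z c) :
    ∀ (M : ℕ) (z : Fin M → E3) (c : Fin M), Function.Injective z →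
      Set.range z = {x : E3 | dist x (z c) ≤ 133 / 10 ∧ ∃ a : Fin 3 → ℤ, x = z c + latPt U fccVec a} →
      TightNearCap (9 / 5) (3 / 2) z c ∨ ExemptNear (9 / 5) ExRec z c ∨ BadNearCap (9 / 5) (3 / 2) z c := by
  intro M z c hz hrange
  rw [range_set_eq_conj σ U (133 / 10) (z c)] at hrange
  exact pruneFcc_comp (permIso σ).symm _ fccVec (133 / 10) h M z c hz hrange

/-! ## §4. The reduction to sorted diagonals -/

/-- ★ **TRANSFER**: the fcc dichotomy (prune ∨ `m`-floor) for the conjugate `V = P_σ U P_σ⁻¹` gives it for `U`. [folklore] -/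
theorem dichotomy_of_conj (σ : Equiv.Perm (Fin 3)) (U : E3 →L[ℝ] E3) {m : ℝ}
    (h : (∀ (M : ℕ) (z : Fin M → E3) (c : Fin M), Function.Injective z →
        Set.range z = {x : E3 | dist x (z c) ≤ 133 / 10 ∧ ∃ a : Fin 3 → ℤ,
          x = z c + latPt ((permIso σ : E3 →L[ℝ] E3).comp (U.comp ((permIso σ).symm : E3 →L[ℝ] E3))) fccVec a} →
        TightNearCap (9 / 5) (3 / 2) z c ∨ ExemptNear (9 / 5) ExRec z c ∨ BadNearCap (9 / 5) (3 / 2) z c) ∨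
      m ≤ (∑ b ∈ (Fintype.piFinset fun _ : Fin 3 => Finset.Icc (-7 : ℤ) 7).filter (fun b => b ≠ 0),
        effPot w₄₅ ω₄ (3 / 400) ‖latPt ((permIso σ : E3 →L[ℝ] E3).comp (U.comp ((permIso σ).symm : E3 →L[ℝ] E3))) fccVec b‖) / 2 -
        (-(7175 / 10000) + 3 / 400)) :
    (∀ (M : ℕ) (z : Fin M → E3) (c : Fin M), Function.Injective z →
        Set.range z = {x : E3 | dist x (z c) ≤ 133 / 10 ∧ ∃ a : Fin 3 → ℤ, x = z c + latPt U fccVec a} →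
        TightNearCap (9 / 5) (3 / 2) z c ∨ ExemptNear (9 / 5) ExRec z c ∨ BadNearCap (9 / 5) (3 / 2) z c) ∨
      m ≤ (∑ b ∈ (Fintype.piFinset fun _ : Fin 3 => Finset.Icc (-7 : ℤ) 7).filter (fun b => b ≠ 0),
        effPot w₄₅ ω₄ (3 / 400) ‖latPt U fccVec b‖) / 2 - (-(7175 / 10000) + 3 / 400) := by
  rcases h with h | h
  · exact Or.inl (prune_of_conj σ U h)
  · right; rwa [boxSum_conj σ U]

/-- Three reals can be sorted by one of six permutations: `∃ σ, d (σ⁻¹ 1) ≤ d (σ⁻¹ 0) ∧ d (σ⁻¹ 2) ≤ d (σ⁻¹ 1)`. [folklore] -/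
theorem exists_perm_sorted (d : Fin 3 → ℝ) :
    ∃ σ : Equiv.Perm (Fin 3), d (σ.symm 1) ≤ d (σ.symm 0) ∧ d (σ.symm 2) ≤ d (σ.symm 1) := by
  -- `τ = σ⁻¹` lists the indices in decreasing order of `d`; we give `τ` and take `σ = τ⁻¹`
  have key : ∀ τ : Equiv.Perm (Fin 3), d (τ 1) ≤ d (τ 0) → d (τ 2) ≤ d (τ 1) →
      ∃ σ : Equiv.Perm (Fin 3), d (σ.symm 1) ≤ d (σ.symm 0) ∧ d (σ.symm 2) ≤ d (σ.symm 1) :=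
    fun τ h1 h2 => ⟨τ.symm, by simpa using h1, by simpa using h2⟩
  rcases le_total (d 1) (d 0) with h01 | h01 <;> rcases le_total (d 2) (d 1) with h12 | h12 <;>
    rcases le_total (d 2) (d 0) with h02 | h02
  · exact key 1 (by simpa using h01) (by simpa using h12)
  · exact key 1 (by simpa using h01) (by simpa using h12)
  · exact key (Equiv.swap 1 2) (by simpa [Equiv.swap_apply_of_ne_of_ne] using h02) (by simpa [Equiv.swap_apply_of_ne_of_ne] using h12)
  · exact key ((Equiv.swap 0 1).trans (Equiv.swap 1 2))
      (by simp [Equiv.swap_apply_of_ne_of_ne]; exact h02) (by simp [Equiv.swap_apply_of_ne_of_ne]; exact h01)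
  · exact key (Equiv.swap 0 1) (by simpa [Equiv.swap_apply_of_ne_of_ne] using h01)
      (by simpa [Equiv.swap_apply_of_ne_of_ne] using h02)
  · exact key ((Equiv.swap 0 1).trans (Equiv.swap 0 2))
      (by simp [Equiv.swap_apply_of_ne_of_ne]; exact h12) (by simp [Equiv.swap_apply_of_ne_of_ne]; exact h02)
  · exact key (Equiv.swap 0 1) (by simpa [Equiv.swap_apply_of_ne_of_ne] using h01)
      (by simpa [Equiv.swap_apply_of_ne_of_ne] using h02)
  · exact key (Equiv.swap 0 2) (by simpa [Equiv.swap_apply_of_ne_of_ne] using h12) (by simpa [Equiv.swap_apply_of_ne_of_ne] using h01)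

/-- ★★ **REDUCTION TO SORTED DIAGONALS.**  If the fcc dichotomy (prune ∨ `m`-floor) holds for every self-adjoint positive `U` with
`‖U − 1‖ ≤ 1/4` whose diagonal entries satisfy `u₁₁ ≤ u₀₀` and `u₂₂ ≤ u₁₁`, it holds for every self-adjoint positive `U` with `‖U − 1‖ ≤ 1/4`
— i.e. the conclusion is EXACTLY the `hfcc` hypothesis of `…HomPrunedPolar.homFloor_of_prunedBoxSums_selfAdjoint`. [folklore] -/
theorem fccHalf_of_sorted {m : ℝ}
    (h : ∀ U : E3 →L[ℝ] E3, (∀ v w : E3, inner ℝ (U v) w = inner ℝ v (U w)) → (∀ w : E3, 0 ≤ inner ℝ w (U w)) → ‖U - 1‖ ≤ 1 / 4 →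
      (U (EuclideanSpace.single 1 (1 : ℝ))) 1 ≤ (U (EuclideanSpace.single 0 (1 : ℝ))) 0 →
      (U (EuclideanSpace.single 2 (1 : ℝ))) 2 ≤ (U (EuclideanSpace.single 1 (1 : ℝ))) 1 →
      (∀ (M : ℕ) (z : Fin M → E3) (c : Fin M), Function.Injective z →
          Set.range z = {x : E3 | dist x (z c) ≤ 133 / 10 ∧ ∃ a : Fin 3 → ℤ, x = z c + latPt U fccVec a} →
          TightNearCap (9 / 5) (3 / 2) z c ∨ ExemptNear (9 / 5) ExRec z c ∨ BadNearCap (9 / 5) (3 / 2) z c) ∨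
      m ≤ (∑ b ∈ (Fintype.piFinset fun _ : Fin 3 => Finset.Icc (-7 : ℤ) 7).filter (fun b => b ≠ 0),
        effPot w₄₅ ω₄ (3 / 400) ‖latPt U fccVec b‖) / 2 - (-(7175 / 10000) + 3 / 400)) :
    ∀ U : E3 →L[ℝ] E3, (∀ v w : E3, inner ℝ (U v) w = inner ℝ v (U w)) → (∀ w : E3, 0 ≤ inner ℝ w (U w)) → ‖U - 1‖ ≤ 1 / 4 →
      (∀ (M : ℕ) (z : Fin M → E3) (c : Fin M), Function.Injective z →
          Set.range z = {x : E3 | dist x (z c) ≤ 133 / 10 ∧ ∃ a : Fin 3 → ℤ, x = z c + latPt U fccVec a} →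
          TightNearCap (9 / 5) (3 / 2) z c ∨ ExemptNear (9 / 5) ExRec z c ∨ BadNearCap (9 / 5) (3 / 2) z c) ∨
      m ≤ (∑ b ∈ (Fintype.piFinset fun _ : Fin 3 => Finset.Icc (-7 : ℤ) 7).filter (fun b => b ≠ 0),
        effPot w₄₅ ω₄ (3 / 400) ‖latPt U fccVec b‖) / 2 - (-(7175 / 10000) + 3 / 400) := by
  intro U hsa hpos hU
  obtain ⟨σ, h1, h2⟩ := exists_perm_sorted fun a => (U (EuclideanSpace.single a (1 : ℝ))) a
  refine dichotomy_of_conj σ U (h _ (conj_selfAdjoint σ hsa) (conj_pos σ hpos) ((conj_norm_sub_one_le σ U).trans hU) ?_ ?_)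
  · rw [conj_entry, conj_entry]; exact h1
  · rw [conj_entry, conj_entry]; exact h2

/-! ## §5. The certificate over the sorted domain: vacuous-leaf verdict, tree and search theorems -/

/-- ★ **DOMAIN PRUNE**: the entry box lies entirely OUTSIDE the sorted domain (`u₀₀ < u₁₁` or `u₁₁ < u₂₂` on the whole box) — a vacuous leaf. -/
def domOut (c w : Fin 3 × Fin 3 → ℤ) : Bool :=
  decide (c (0, 0) + w (0, 0) < c (1, 1) - w (1, 1)) || decide (c (1, 1) + w (1, 1) < c (2, 2) - w (2, 2))

/-- Soundness of the domain prune: no `U` with entries in the box has a sorted diagonal. [folklore] -/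
theorem false_of_domOut {c w : Fin 3 × Fin 3 → ℤ} (h : domOut c w = true) {u : Fin 3 × Fin 3 → ℝ}
    (hbox : ∀ ab, |u ab - (c ab : ℝ) / SC| ≤ (w ab : ℝ) / SC) (h1 : u (1, 1) ≤ u (0, 0)) (h2 : u (2, 2) ≤ u (1, 1)) : False := by
  have hS := SC_pos
  have key : ∀ ab ab' : Fin 3 × Fin 3, u ab' ≤ u ab → ¬ (c ab + w ab < c ab' - w ab') := by
    intro ab ab' hle hlt
    have ha := (abs_le.1 (hbox ab)).2
    have hb := (abs_le.1 (hbox ab')).1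
    have hlt' : ((c ab : ℝ) + w ab) / SC < ((c ab' : ℝ) - w ab') / SC := by
      exact div_lt_div_of_pos_right (by exact_mod_cast hlt) hS
    rw [add_div, sub_div] at hlt'
    linarith
  simp only [domOut, Bool.or_eq_true, decide_eq_true_eq] at h
  rcases h with h | h
  · exact key (0, 0) (1, 1) h1 h
  · exact key (1, 1) (2, 2) h2 h

/-- ★ **ENTRY-LEAF VERDICT OVER THE SORTED DOMAIN**: domain prune ∨ `entryLeafOKT μ` ((P1) fit ∨ symmetry ∨ column ∨ TABLE (P4)). -/
def entryLeafOKS (μ : ℤ) (c w : Fin 3 × Fin 3 → ℤ) : Bool := domOut c w || entryLeafOKT μ c w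

/-- ★ Soundness of `entryLeafOKS` RELATIVE to the sorted domain. [folklore] -/
theorem entryLeafOKS_sound {μ : ℤ} {c w : Fin 3 × Fin 3 → ℤ} (h : entryLeafOKS μ c w = true) (U : E3 →L[ℝ] E3)
    (hsa : ∀ v v' : E3, ⟪U v, v'⟫ = ⟪v, U v'⟫) (hU : ‖U - 1‖ ≤ 1 / 4)
    (hbox : ∀ ab : Fin 3 × Fin 3, |(U (EuclideanSpace.single ab.2 (1 : ℝ))) ab.1 - (c ab : ℝ) / SC| ≤ (w ab : ℝ) / SC)
    (h1 : (U (EuclideanSpace.single 1 (1 : ℝ))) 1 ≤ (U (EuclideanSpace.single 0 (1 : ℝ))) 0)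
    (h2 : (U (EuclideanSpace.single 2 (1 : ℝ))) 2 ≤ (U (EuclideanSpace.single 1 (1 : ℝ))) 1) :
    (∀ (M : ℕ) (z : Fin M → E3) (c : Fin M), Function.Injective z →
        Set.range z = {x : E3 | dist x (z c) ≤ 133 / 10 ∧ ∃ a : Fin 3 → ℤ, x = z c + latPt U fccVec a} →
        TightNearCap (9 / 5) (3 / 2) z c ∨ ExemptNear (9 / 5) ExRec z c ∨ BadNearCap (9 / 5) (3 / 2) z c) ∨
      (μ : ℝ) / SC ≤ ∑ b ∈ (Fintype.piFinset fun _ : Fin 3 => Finset.Icc (-7 : ℤ) 7).filter (fun b => b ≠ 0),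
        effPot w₄₅ ω₄ (3 / 400) ‖latPt U fccVec b‖ := by
  simp only [entryLeafOKS, Bool.or_eq_true] at h
  rcases h with h | h
  · exact (false_of_domOut h (u := fun ab : Fin 3 × Fin 3 => (U (EuclideanSpace.single ab.2 (1 : ℝ))) ab.1) hbox h1 h2).elim
  · exact entryLeafOKT_sound h U hsa hU hbox

/-- ★★ **THE fcc HALF FROM ONE TREE VERDICT OVER THE SORTED DOMAIN** (generic verdict): if a leaf verdict is sound RELATIVE to the sorted
domain (hver with the two extra hypotheses `u₁₁ ≤ u₀₀`, `u₂₂ ≤ u₁₁`) and the driver accepts the root cube, then `hfcc` holds verbatim (for ALL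
self-adjoint positive `U` with `‖U − 1‖ ≤ 1/4`) for every `m` with `2 (m + e_W) SC ≤ μ`. [folklore] -/
theorem fccHalf_of_entryTreeSorted {m : ℝ} {μ : ℤ} (hμ : 2 * (m + (-(7175 / 10000) + 3 / 400)) * SC ≤ μ)
    (verdict : (Fin 3 × Fin 3 → ℤ) → (Fin 3 × Fin 3 → ℤ) → Bool)
    (hver : ∀ c w, verdict c w = true → ∀ U : E3 →L[ℝ] E3, (∀ v v' : E3, ⟪U v, v'⟫ = ⟪v, U v'⟫) → ‖U - 1‖ ≤ 1 / 4 →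
      (∀ ab : Fin 3 × Fin 3, |(U (EuclideanSpace.single ab.2 (1 : ℝ))) ab.1 - (c ab : ℝ) / SC| ≤ (w ab : ℝ) / SC) →
      (U (EuclideanSpace.single 1 (1 : ℝ))) 1 ≤ (U (EuclideanSpace.single 0 (1 : ℝ))) 0 →
      (U (EuclideanSpace.single 2 (1 : ℝ))) 2 ≤ (U (EuclideanSpace.single 1 (1 : ℝ))) 1 →
      (∀ (M : ℕ) (z : Fin M → E3) (c : Fin M), Function.Injective z →
          Set.range z = {x : E3 | dist x (z c) ≤ 133 / 10 ∧ ∃ a : Fin 3 → ℤ, x = z c + latPt U fccVec a} →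
          TightNearCap (9 / 5) (3 / 2) z c ∨ ExemptNear (9 / 5) ExRec z c ∨ BadNearCap (9 / 5) (3 / 2) z c) ∨
        (μ : ℝ) / SC ≤ ∑ b ∈ (Fintype.piFinset fun _ : Fin 3 => Finset.Icc (-7 : ℤ) 7).filter (fun b => b ≠ 0),
          effPot w₄₅ ω₄ (3 / 400) ‖latPt U fccVec b‖)
    {t : CertTree (Fin 3 × Fin 3)} (h : treeOK verdict t rootC rootW = true) :
    ∀ U : E3 →L[ℝ] E3, (∀ v w : E3, inner ℝ (U v) w = inner ℝ v (U w)) → (∀ w : E3, 0 ≤ inner ℝ w (U w)) → ‖U - 1‖ ≤ 1 / 4 →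
      (∀ (M : ℕ) (z : Fin M → E3) (c : Fin M), Function.Injective z →
          Set.range z = {x : E3 | dist x (z c) ≤ 133 / 10 ∧ ∃ a : Fin 3 → ℤ, x = z c + latPt U fccVec a} →
          TightNearCap (9 / 5) (3 / 2) z c ∨ ExemptNear (9 / 5) ExRec z c ∨ BadNearCap (9 / 5) (3 / 2) z c) ∨
      m ≤ (∑ b ∈ (Fintype.piFinset fun _ : Fin 3 => Finset.Icc (-7 : ℤ) 7).filter (fun b => b ≠ 0),
        effPot w₄₅ ω₄ (3 / 400) ‖latPt U fccVec b‖) / 2 - (-(7175 / 10000) + 3 / 400) := by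
  refine fccHalf_of_sorted fun U hsa _hpos hU h1 h2 => ?_
  have hS := SC_pos
  have key := treeOK_sound SC_pos
    (P := fun x : Fin 3 × Fin 3 → ℝ => ∀ U : E3 →L[ℝ] E3, (∀ v v' : E3, ⟪U v, v'⟫ = ⟪v, U v'⟫) → ‖U - 1‖ ≤ 1 / 4 →
      (∀ ab : Fin 3 × Fin 3, (U (EuclideanSpace.single ab.2 (1 : ℝ))) ab.1 = x ab) →
      (U (EuclideanSpace.single 1 (1 : ℝ))) 1 ≤ (U (EuclideanSpace.single 0 (1 : ℝ))) 0 →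
      (U (EuclideanSpace.single 2 (1 : ℝ))) 2 ≤ (U (EuclideanSpace.single 1 (1 : ℝ))) 1 →
      (∀ (M : ℕ) (z : Fin M → E3) (c : Fin M), Function.Injective z →
          Set.range z = {x : E3 | dist x (z c) ≤ 133 / 10 ∧ ∃ a : Fin 3 → ℤ, x = z c + latPt U fccVec a} →
          TightNearCap (9 / 5) (3 / 2) z c ∨ ExemptNear (9 / 5) ExRec z c ∨ BadNearCap (9 / 5) (3 / 2) z c) ∨
        (μ : ℝ) / SC ≤ ∑ b ∈ (Fintype.piFinset fun _ : Fin 3 => Finset.Icc (-7 : ℤ) 7).filter (fun b => b ≠ 0),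
          effPot w₄₅ ω₄ (3 / 400) ‖latPt U fccVec b‖)
    verdict (fun c w hv x hx V hVsa hV1 hVx => hver c w hv V hVsa hV1 fun ab => by rw [hVx ab]; exact hx ab) t rootC rootW h
    (fun ab => (U (EuclideanSpace.single ab.2 (1 : ℝ))) ab.1) (mem_root_of_near_one hU) U hsa hU (fun _ => rfl) h1 h2
  refine key.imp id fun hfloor => ?_
  have h2' : 2 * (m + (-(7175 / 10000) + 3 / 400)) ≤ (μ : ℝ) / SC := by
    rw [le_div_iff₀ hS]; exact hμ
  linarith

/-- ★★ The same from ONE SEARCH Boolean over the sorted domain. [folklore] -/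
theorem fccHalf_of_entrySearchSorted {m : ℝ} {μ : ℤ} (hμ : 2 * (m + (-(7175 / 10000) + 3 / 400)) * SC ≤ μ)
    {sel : ℕ → (Fin 3 × Fin 3 → ℤ) → (Fin 3 × Fin 3 → ℤ) → Fin 3 × Fin 3} {fuel d : ℕ}
    (h : searchOK (entryLeafOKS μ) sel fuel d rootC rootW = true) :
    ∀ U : E3 →L[ℝ] E3, (∀ v w : E3, inner ℝ (U v) w = inner ℝ v (U w)) → (∀ w : E3, 0 ≤ inner ℝ w (U w)) → ‖U - 1‖ ≤ 1 / 4 →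
      (∀ (M : ℕ) (z : Fin M → E3) (c : Fin M), Function.Injective z →
          Set.range z = {x : E3 | dist x (z c) ≤ 133 / 10 ∧ ∃ a : Fin 3 → ℤ, x = z c + latPt U fccVec a} →
          TightNearCap (9 / 5) (3 / 2) z c ∨ ExemptNear (9 / 5) ExRec z c ∨ BadNearCap (9 / 5) (3 / 2) z c) ∨
      m ≤ (∑ b ∈ (Fintype.piFinset fun _ : Fin 3 => Finset.Icc (-7 : ℤ) 7).filter (fun b => b ≠ 0),
        effPot w₄₅ ω₄ (3 / 400) ‖latPt U fccVec b‖) / 2 - (-(7175 / 10000) + 3 / 400) := by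
  obtain ⟨t, ht⟩ := exists_tree_of_searchOK (entryLeafOKS μ) sel fuel d rootC rootW h
  exact fccHalf_of_entryTreeSorted hμ (entryLeafOKS μ) (fun _ _ hv U hsa hU hbox h1 h2 => entryLeafOKS_sound hv U hsa hU hbox h1 h2) ht

/-- ★★★ **`(H) HomFloor m` FROM TWO SEARCH BOOLEANS, the fcc search restricted to SORTED boxes** (`entryLeafOKS μ` = domain prune ∨ fit ∨
symmetry ∨ column ∨ table); hcp side hand-2's `entryLeafOKH2 μ` as in `…HomEntrySearch.homFloor_of_entrySearches`. [folklore] -/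
theorem homFloor_of_entrySearchesSorted {m : ℝ} {μ : ℤ} (hμ : 2 * (m + (-(7175 / 10000) + 3 / 400)) * SC ≤ μ)
    {selF : ℕ → (Fin 3 × Fin 3 → ℤ) → (Fin 3 × Fin 3 → ℤ) → Fin 3 × Fin 3} {fuelF dF : ℕ}
    (hF : searchOK (entryLeafOKS μ) selF fuelF dF rootC rootW = true)
    {selH : ℕ → ((Fin 3 × Fin 3) ⊕ Fin 3 → ℤ) → ((Fin 3 × Fin 3) ⊕ Fin 3 → ℤ) → (Fin 3 × Fin 3) ⊕ Fin 3} {fuelH dH : ℕ}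
    (hH : searchOK (entryLeafOKH2 μ) selH fuelH dH rootCH rootWH = true) : HomFloor m :=
  homFloor_of_prunedBoxSums_selfAdjoint (fccHalf_of_entrySearchSorted hμ hF)
    (hcpHalf_of_entrySearch hμ (entryLeafOKH2 μ) (fun _ _ hv U ξ hsa hU hbox hξ => entryLeafOKH2_sound hv U ξ hsa hU hbox hξ) hH)

/-! ## §6. Kernel smoke tests -/

/-- The domain prune fires on a box with `u₀₀ < u₁₁` throughout and not on the root cube; the sorted verdict accepts such a box at depth 0. -/
example : domOut (Function.update rootC (1, 1) (281474976710656 + 3000)) (fun _ => 1000) = true ∧ domOut rootC rootW = false ∧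
    entryLeafOKS muRec (Function.update rootC (1, 1) (281474976710656 + 3000)) (fun _ => 1000) = true := by
  decide +kernel

end Summit.AtomisticToContinuum.Crystallization.Theorems.FrustratedLawDichotomyStrainedPatchHomEntrySym
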